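import Summits.CriticalPhenomena.PercolationContinuityZ3.Theorems.PercNearOneGluingNoHeavyConstsTwoPoleCore
import HarnessLib

/-!
# The `K₄` core (triangle of terminals plus a hub): polynomial inequalities for TS / DUU

builds on p205010 (kernel theorem, internal audit signed; external expert review pending)

Lane `prim/consts`, seat prim-consts-1 gen 12 (memo `FROM-prim-consts-1-g12-TWO-POLE.md` §6).  Helper file for the crux `NoHeavyLowerTail`
(stmt-CriticalPhenomena-4575; `--supports`): theorems only, no definitions, no sorries, standard axioms.  Consumed by `…ConstsTripleSplitHub`
(TS/DUU for a TRIANGLE WITH A HUB: three terminals pairwise joined by arcs and each joined to a common hub by a spoke — the `K₄` pattern, the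
smallest 2-connected core that is neither a cycle nor a `K_{2,k}`-subdivision).

THE CORE COMPUTATION.  Arcs `ab, ac, bc` open with probabilities `p, q, r`; spokes `a–h, b–h, c–h` open with probabilities `x_a, x_b, x_c`; all
independent.  Exactly (64-state enumeration, `prim-consts-1/g12/eng/k4_setup.py`):  `μ(a|b|c) = (1−p)(1−q)(1−r)·S(x)` (no arc, at most one
spoke), `μ(a ↮ b, a ↮ c) = (1−p)(1−q)·D(x)`, `μ(b ↮ c) = (1−r)·V` with
`V = (1−p)(1−q)(1−x_bx_c) + p(1−q)m_c + (1−p)q·m_b`,  `m_c = 1 − x_c(x_a + x_b − x_ax_b)`, `m_b = 1 − x_b(x_a + x_c − x_ax_c)`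
(`S, D` as in `…ConstsTwoPoleCore`).  DUU(root `a`) is `(1−p)(1−q)(1−r)²S(x)² ≤ D(x)·(1−r)²V²`; after the Cauchy–Schwarz step
`S² ≤ D·L` (`Consts.TwoPole.sq_S_le`, `L = (1−x_a)X² + x_aX'`, `X = 1−x_bx_c`, `X' = (1−x_b)(1−x_c)`) it remains to show the KEY
`(1−p)(1−q)·L ≤ V²` (`Consts.K4.key_le`), which follows from `(1−p)(1−q) = (α+β)(α+γ)` for `α = (1−p)(1−q)`, `β = p(1−q)`, `γ = (1−p)q` and
`V² − (α+β)(α+γ)L = α²(X² − L) + αβ(2Xm_c − L) + αγ(2Xm_b − L) + [(βm_c + γm_b)² − βγL]`, each bracket nonnegative: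
`X² − L = x_a(X² − X')`, `2Xm_c − L = (1−x_a)X² + x_a(1−x_c)(1 + x_b − 2x_bx_c)`, `(βm_c + γm_b)² ≥ 4βγm_bm_c` and
`4m_bm_c − L = 3(1−x_a)²X² + 3x_a²X' + x_a(1−x_a)(4XX' + 2X² + (X² − X'))`.  (Tensor-Bernstein certificate sizes for comparison: DUU 222, TS 695.)
References: G. Grimmett, *Percolation* (1999), §1.3, §2.2.
-/

namespace Summit.CriticalPhenomena.PercolationContinuityZ3.Theorems

open MeasureTheory Set Literature.Probability.LatticeModels Literature.Probability.Percolation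
open scoped Classical

namespace Consts

namespace K4

/-- `X² − X' ≥ 0` for `X = 1 − x_bx_c`, `X' = (1−x_b)(1−x_c)`: the difference is `x_b(1−x_c)² + x_c(1−x_b)² + x_bx_c(1−x_b)(1−x_c)`. [folklore] -/
theorem delta_nonneg (xb xc : ℝ) (hb : 0 ≤ xb) (hb' : xb ≤ 1) (hc : 0 ≤ xc) (hc' : xc ≤ 1) :
    0 ≤ (1 - xb * xc) ^ 2 - (1 - xb) * (1 - xc) := by
  have e : (1 - xb * xc) ^ 2 - (1 - xb) * (1 - xc) = xb * (1 - xc) ^ 2 + xc * (1 - xb) ^ 2 + xb * xc * ((1 - xb) * (1 - xc)) := by ring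
  rw [e]
  exact add_nonneg (add_nonneg (mul_nonneg hb (sq_nonneg _)) (mul_nonneg hc (sq_nonneg _)))
    (mul_nonneg (mul_nonneg hb hc) (mul_nonneg (sub_nonneg.2 hb') (sub_nonneg.2 hc')))

set_option maxHeartbeats 400000 in
/-- **The key inequality of the `K₄` core**: `(1−p)(1−q)·L ≤ V²` (notation of the module docstring), all variables in `[0,1]`. [folklore] -/
theorem key_le (p q xa xb xc : ℝ) (hp : 0 ≤ p) (hp' : p ≤ 1) (hq : 0 ≤ q) (hq' : q ≤ 1) (ha : 0 ≤ xa) (ha' : xa ≤ 1) (hb : 0 ≤ xb)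
    (hb' : xb ≤ 1) (hc : 0 ≤ xc) (hc' : xc ≤ 1) :
    (1 - p) * (1 - q) * ((1 - xa) * (1 - xb * xc) ^ 2 + xa * ((1 - xb) * (1 - xc))) ≤
      ((1 - p) * (1 - q) * (1 - xb * xc) + p * (1 - q) * (1 - xc * (xa + xb - xa * xb)) +
        (1 - p) * q * (1 - xb * (xa + xc - xa * xc))) ^ 2 := by
  set X : ℝ := 1 - xb * xc with hX
  set X' : ℝ := (1 - xb) * (1 - xc) with hX'
  set L : ℝ := (1 - xa) * X ^ 2 + xa * X' with hL
  set mc : ℝ := 1 - xc * (xa + xb - xa * xb) with hmc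
  set mb : ℝ := 1 - xb * (xa + xc - xa * xc) with hmb
  set α : ℝ := (1 - p) * (1 - q) with hα
  set β : ℝ := p * (1 - q) with hβ
  set γ : ℝ := (1 - p) * q with hγ
  have hα0 : 0 ≤ α := mul_nonneg (sub_nonneg.2 hp') (sub_nonneg.2 hq')
  have hβ0 : 0 ≤ β := mul_nonneg hp (sub_nonneg.2 hq')
  have hγ0 : 0 ≤ γ := mul_nonneg (sub_nonneg.2 hp') hq
  have hX0 : 0 ≤ X := sub_nonneg.2 (mul_le_one₀ hb' hc hc')
  have hX'0 : 0 ≤ X' := mul_nonneg (sub_nonneg.2 hb') (sub_nonneg.2 hc')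
  have hδ : 0 ≤ X ^ 2 - X' := delta_nonneg xb xc hb hb' hc hc'
  -- the four brackets
  have b1 : 0 ≤ X ^ 2 - L := by
    have e : X ^ 2 - L = xa * (X ^ 2 - X') := by rw [hL]; ring
    rw [e]; exact mul_nonneg ha hδ
  have b2 : 0 ≤ 2 * X * mc - L := by
    have e : 2 * X * mc - L = (1 - xa) * X ^ 2 + xa * ((1 - xc) * (1 + xb - 2 * xb * xc)) := by rw [hL, hmc, hX, hX']; ring
    rw [e]
    have h3 : 0 ≤ 1 + xb - 2 * xb * xc := by nlinarith [mul_le_one₀ hb' hc hc', mul_nonneg hb (sub_nonneg.2 hc')]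
    exact add_nonneg (mul_nonneg (sub_nonneg.2 ha') (sq_nonneg _)) (mul_nonneg ha (mul_nonneg (sub_nonneg.2 hc') h3))
  have b3 : 0 ≤ 2 * X * mb - L := by
    have e : 2 * X * mb - L = (1 - xa) * X ^ 2 + xa * ((1 - xb) * (1 + xc - 2 * xc * xb)) := by rw [hL, hmb, hX, hX']; ring
    rw [e]
    have h3 : 0 ≤ 1 + xc - 2 * xc * xb := by nlinarith [mul_le_one₀ hc' hb hb', mul_nonneg hc (sub_nonneg.2 hb')]
    exact add_nonneg (mul_nonneg (sub_nonneg.2 ha') (sq_nonneg _)) (mul_nonneg ha (mul_nonneg (sub_nonneg.2 hb') h3))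
  have b4 : 0 ≤ 4 * mb * mc - L := by
    have e : 4 * mb * mc - L = 3 * (1 - xa) ^ 2 * X ^ 2 + 3 * xa ^ 2 * X' + xa * (1 - xa) * (4 * X * X' + 2 * X ^ 2 + (X ^ 2 - X')) := by
      rw [hL, hmb, hmc, hX, hX']; ring
    rw [e]
    exact add_nonneg (add_nonneg (mul_nonneg (mul_nonneg (by norm_num) (sq_nonneg _)) (sq_nonneg _))
      (mul_nonneg (mul_nonneg (by norm_num) (sq_nonneg _)) hX'0))
      (mul_nonneg (mul_nonneg ha (sub_nonneg.2 ha')) (add_nonneg (add_nonneg (mul_nonneg (mul_nonneg (by norm_num) hX0) hX'0)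
        (mul_nonneg (by norm_num) (sq_nonneg _))) hδ))
  have b5 : β * γ * L ≤ (β * mc + γ * mb) ^ 2 := by
    have e : (β * mc + γ * mb) ^ 2 - 4 * (β * γ) * (mb * mc) = (β * mc - γ * mb) ^ 2 := by ring
    have h4 : β * γ * L ≤ β * γ * (4 * mb * mc) := mul_le_mul_of_nonneg_left (by linarith) (mul_nonneg hβ0 hγ0)
    nlinarith [sq_nonneg (β * mc - γ * mb)]
  -- the decomposition
  have ident : (α * X + β * mc + γ * mb) ^ 2 - (1 - p) * (1 - q) * L =
      α ^ 2 * (X ^ 2 - L) + α * β * (2 * X * mc - L) + α * γ * (2 * X * mb - L) + ((β * mc + γ * mb) ^ 2 - β * γ * L) := by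
    have hpq : (1 - p) * (1 - q) = (α + β) * (α + γ) := by rw [hα, hβ, hγ]; ring
    rw [hpq]; ring
  have key : 0 ≤ (α * X + β * mc + γ * mb) ^ 2 - (1 - p) * (1 - q) * L := by
    rw [ident]
    exact add_nonneg (add_nonneg (add_nonneg (mul_nonneg (sq_nonneg _) b1) (mul_nonneg (mul_nonneg hα0 hβ0) b2))
      (mul_nonneg (mul_nonneg hα0 hγ0) b3)) (sub_nonneg.2 b5)
  have hV : (1 - p) * (1 - q) * (1 - xb * xc) + p * (1 - q) * (1 - xc * (xa + xb - xa * xb)) + (1 - p) * q * (1 - xb * (xa + xc - xa * xc)) =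
      α * X + β * mc + γ * mb := by rw [hα, hβ, hγ, hX, hmc, hmb]
  rw [hV]
  linarith

/-- **The `K₄` polynomial inequality (DUU on the core, root `a`)**: `((1−p)(1−q)(1−r)S(x))² ≤ ((1−p)(1−q)D(x))·((1−r)V)²` for all variables
in `[0,1]` (notation of the module docstring). [folklore] -/
theorem poly_DUU (p q r xa xb xc : ℝ) (hp : 0 ≤ p) (hp' : p ≤ 1) (hq : 0 ≤ q) (hq' : q ≤ 1) (ha : 0 ≤ xa) (ha' : xa ≤ 1)
    (hb : 0 ≤ xb) (hb' : xb ≤ 1) (hc : 0 ≤ xc) (hc' : xc ≤ 1) :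
    ((1 - p) * (1 - q) * (1 - r) * (1 - xa * xb - xa * xc - xb * xc + 2 * xa * xb * xc)) ^ 2 ≤
      ((1 - p) * (1 - q) * (1 - xa * (xb + xc - xb * xc))) *
        ((1 - r) * ((1 - p) * (1 - q) * (1 - xb * xc) + p * (1 - q) * (1 - xc * (xa + xb - xa * xb)) +
          (1 - p) * q * (1 - xb * (xa + xc - xa * xc)))) ^ 2 := by
  have hS := TwoPole.sq_S_le xa xb xc ha ha' hb' hc'
  have hK := key_le p q xa xb xc hp hp' hq hq' ha ha' hb hb' hc hc'
  have hpq : 0 ≤ (1 - p) * (1 - q) := mul_nonneg (sub_nonneg.2 hp') (sub_nonneg.2 hq')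
  have hX' : 0 ≤ (1 - xb) * (1 - xc) := mul_nonneg (sub_nonneg.2 hb') (sub_nonneg.2 hc')
  have hD : 0 ≤ 1 - xa * (xb + xc - xb * xc) := by
    have e : 1 - xa * (xb + xc - xb * xc) = (1 - xa) + xa * ((1 - xb) * (1 - xc)) := by ring
    rw [e]; exact add_nonneg (sub_nonneg.2 ha') (mul_nonneg ha hX')
  calc ((1 - p) * (1 - q) * (1 - r) * (1 - xa * xb - xa * xc - xb * xc + 2 * xa * xb * xc)) ^ 2
      = ((1 - p) * (1 - q)) * (1 - r) ^ 2 * (((1 - p) * (1 - q)) * (1 - xa * xb - xa * xc - xb * xc + 2 * xa * xb * xc) ^ 2) := by ring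
    _ ≤ ((1 - p) * (1 - q)) * (1 - r) ^ 2 * (((1 - p) * (1 - q)) *
          ((1 - xa * (xb + xc - xb * xc)) * ((1 - xa) * (1 - xb * xc) ^ 2 + xa * ((1 - xb) * (1 - xc))))) :=
        mul_le_mul_of_nonneg_left (mul_le_mul_of_nonneg_left hS hpq) (mul_nonneg hpq (sq_nonneg _))
    _ = ((1 - p) * (1 - q) * (1 - xa * (xb + xc - xb * xc))) * (1 - r) ^ 2 *
          ((1 - p) * (1 - q) * ((1 - xa) * (1 - xb * xc) ^ 2 + xa * ((1 - xb) * (1 - xc)))) := by ring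
    _ ≤ ((1 - p) * (1 - q) * (1 - xa * (xb + xc - xb * xc))) * (1 - r) ^ 2 *
          ((1 - p) * (1 - q) * (1 - xb * xc) + p * (1 - q) * (1 - xc * (xa + xb - xa * xb)) +
            (1 - p) * q * (1 - xb * (xa + xc - xa * xc))) ^ 2 :=
        mul_le_mul_of_nonneg_left hK (mul_nonneg (mul_nonneg hpq hD) (sq_nonneg _))
    _ = _ := by ring

/-- `0 ≤ V`. [folklore] -/
theorem V_nonneg (p q xa xb xc : ℝ) (hp : 0 ≤ p) (hp' : p ≤ 1) (hq : 0 ≤ q) (hq' : q ≤ 1) (ha : 0 ≤ xa) (ha' : xa ≤ 1) (hb : 0 ≤ xb)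
    (hb' : xb ≤ 1) (hc : 0 ≤ xc) (hc' : xc ≤ 1) :
    0 ≤ (1 - p) * (1 - q) * (1 - xb * xc) + p * (1 - q) * (1 - xc * (xa + xb - xa * xb)) + (1 - p) * q * (1 - xb * (xa + xc - xa * xc)) := by
  have hab : xa + xb - xa * xb ≤ 1 := by nlinarith [mul_nonneg (sub_nonneg.2 ha') (sub_nonneg.2 hb')]
  have hac : xa + xc - xa * xc ≤ 1 := by nlinarith [mul_nonneg (sub_nonneg.2 ha') (sub_nonneg.2 hc')]
  have hab0 : 0 ≤ xa + xb - xa * xb := by nlinarith [mul_le_one₀ ha' hb hb']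
  have hac0 : 0 ≤ xa + xc - xa * xc := by nlinarith [mul_le_one₀ ha' hc hc']
  refine add_nonneg (add_nonneg ?_ ?_) ?_
  · exact mul_nonneg (mul_nonneg (sub_nonneg.2 hp') (sub_nonneg.2 hq')) (sub_nonneg.2 (mul_le_one₀ hb' hc hc'))
  · exact mul_nonneg (mul_nonneg hp (sub_nonneg.2 hq')) (sub_nonneg.2 (mul_le_one₀ hc' hab0 hab))
  · exact mul_nonneg (mul_nonneg (sub_nonneg.2 hp') hq) (sub_nonneg.2 (mul_le_one₀ hb' hac0 hac))

end K4

end Consts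

end Summit.CriticalPhenomena.PercolationContinuityZ3.Theorems
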